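import Summits.BirchSwinnertonDyer.BirchSwinnertonDyer.Theorems.PrintX11aLowerHalfAtThreeOfChildren
import Summits.BirchSwinnertonDyer.BirchSwinnertonDyer.Theses.ClassRecordThree
import Summits.BirchSwinnertonDyer.BirchSwinnertonDyer.Theses.KolyvaginRoadThree
import HarnessLib

/-!
# Item `X11aLowerHalfAtThree` (stmt-BirchSwinnertonDyer-23178; routes `ClassRecordThree` ∕ `KolyvaginRoadThree`) BY NAME from crux L's line r17
# (lead bsd-line-x11a-p1 gen 9; companion of `Theorems/PrintX11aLowerHalfAtThreeOfChildren.lean`; `--supports stmt-BirchSwinnertonDyer-19064` helper)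

HONEST FRAMING.  Three by-name wrappers and one `Iff.rfl`; no definition, no named fact, no `sorry`; every theorem is CONDITIONAL on its
displayed binders and closes nothing by itself (Mazur's cyclotomic main conjecture at the très-ramifié deep X11a pairs at `3`, `hMC3`, is OPEN).
Kept apart from the text-level companion so that the latter's import cone stays inside the x11a cell: the two route files imported here are
re-rendered by their planners many times a day.  No summit statement is proved; BSD is proved for no curve and no class.

* `Birth.x11aLowerHalfAtThree_classRecordThree_iff_kolyvaginRoadThree` — the two route spellings of 23178 are one statement (`Iff.rfl`);
* `Birth.x11aLowerHalfAtThree_of_children_r17_three h9 h2L hQ3 hMC3 : Theses.ClassRecordThree.X11aLowerHalfAtThree` — **PLANNER TURNKEY for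
  23178** from line r17's `p = 3` children (the shared nine, Kato–Wuthrich A32 ∧ GZK, the three partner facts, `hMC3`), := the companion's
  `lowerAtThree_of_children_r17_three`; + the `KolyvaginRoadThree` spelling;
* `Birth.x11aLowerHalfAtThree_of_x11aLowerHalf : Theses.PrintX11a.X11aLowerHalf → Theses.ClassRecordThree.X11aLowerHalfAtThree` — 23178 ⟸ crux
  19064 BY NAME (restriction to `p = 3`).

References: [Miller2011LMS] Def. 1.1 (arXiv:1010.2431 p. 3); [Skinner2016PacificMC] Thm. A ∕ C (shape); [SkinnerUrban2014] Thm. 3.29 (shape);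
cell file `Cruxes/X11aLowerHalf/Lines/birth.lean` (r17).
-/

set_option autoImplicit false
set_option linter.dupNamespace false -- the directory name repeats the summit name (sibling precedent)

noncomputable section

open scoped Classical

open WeierstrassCurve
  Literature.NumberTheory.EllipticCurves
  Literature.NumberTheory.EllipticCurves.ModularForms
  Literature.NumberTheory.EllipticCurves.Rank1Residual
  Literature.NumberTheory.EllipticCurves.Rank1Residual.Typed
  Literature.NumberTheory.EllipticCurves.Wuthrich2014
  Literature.NumberTheory.EllipticCurves.SteinWuthrich2013
  Literature.NumberTheory.EllipticCurves.Greenberg1999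
  Literature.NumberTheory.EllipticCurves.Kato2004
  Literature.NumberTheory.EllipticCurves.EmertonPollackWeston2006
  Summit.BirchSwinnertonDyer.Rank1Residual
  Summit.BirchSwinnertonDyer.Rank1Residual.X11a

namespace Summit.BirchSwinnertonDyer.BirchSwinnertonDyer.Theorems.Birth

/-- The two route spellings of item 23178 are ONE statement (`Iff.rfl`). Bookkeeping; closes nothing.
[cite: Miller2011LMS, Def. 1.1 (arXiv:1010.2431 p. 3)] -/
theorem x11aLowerHalfAtThree_classRecordThree_iff_kolyvaginRoadThree :
    Summit.BirchSwinnertonDyer.BirchSwinnertonDyer.Theses.ClassRecordThree.X11aLowerHalfAtThree ↔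
      Summit.BirchSwinnertonDyer.BirchSwinnertonDyer.Theses.KolyvaginRoadThree.X11aLowerHalfAtThree :=
  Iff.rfl

/-- **Item 23178 BY NAME ⟸ crux L BY NAME** (restriction to `p = 3`): if item 19064 `X11aLowerHalf` is ever closed, 23178 follows by this
one-liner (`X11aLowerHalfAtThree_holds := Birth.x11aLowerHalfAtThree_of_x11aLowerHalf X11aLowerHalf_holds`).  Bookkeeping; CONDITIONAL on
the crux (OPEN); closes nothing. [cite: Miller2011LMS, Def. 1.1 (arXiv:1010.2431 p. 3)] -/
theorem x11aLowerHalfAtThree_of_x11aLowerHalf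
    (h : Summit.BirchSwinnertonDyer.BirchSwinnertonDyer.Theses.PrintX11a.X11aLowerHalf) :
    Summit.BirchSwinnertonDyer.BirchSwinnertonDyer.Theses.ClassRecordThree.X11aLowerHalfAtThree :=
  lowerAtThree_of_x11aLowerHalf h

/-- **Item 23178 `X11aLowerHalfAtThree` BY NAME (route `ClassRecordThree`) from line r17's `p = 3` CHILDREN** (binders byte-equal to the
registered stub texts of crux L's line r17): the shared nine `h9` (= `stub_nineFactsOddGS`, crux U3's text), the two-fact child `h2L`
(= `stub_katoGZKFactsLower`: Kato–Wuthrich A32 ∧ GZK), the three partner facts `hQ3` (= `stub_threePartnerFactsLower`) and `hMC3`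
(= `stub_mazurMCAtTresRamifieThree`: Mazur's cyclotomic main conjecture at every très-ramifié deep X11a pair at `3`; OPEN — printed only under
(ram), Skinner 2016 Thm. A).  := the companion's `lowerAtThree_of_children_r17_three` (body = p646859's
`ThreePartner.lowerThreeDeep_of_partnerFF_of_mazurTR_of_facts`).  PLANNER TURNKEY for 23178 (W-81′): `X11aLowerHalfAtThree_holds :=
Birth.x11aLowerHalfAtThree_of_children_r17_three C_nine C_katoGZK C_facts3 C_MC3`.  CONDITIONAL; closes nothing; BSD is not proved.
[cite: MazurTateTeitelbaum1986Invent, §I.14 (shape only)] [cite: Skinner2016PacificMC, Thm. A (shape only; printed under (ram))]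
[cite: EmertonPollackWeston2006, Cor. 5.1.4, Thm. 1] [cite: YanZhu2024MainConjNonCM, Thm. 4.9] [cite: Fisher2012Hessian, Thm. 13.2 (n = 3)]
[cite: Wuthrich2014, Thm. 3 (p. 382), Lemma 20 (p. 400)] [cite: Miller2011LMS, Def. 1.1 (arXiv:1010.2431 p. 3)] -/
theorem x11aLowerHalfAtThree_of_children_r17_three
    (h9 : thm61_splitMultiplicative ∧ thm61_nonsplitMultiplicative ∧
      (∀ (W : WeierstrassCurve ℚ) [W.IsElliptic] [W.IsGloballyMinimal] (p : ℕ) [Fact p.Prime],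
        p ≠ 2 → greenberg_stevens (W := W) (p := p)) ∧
      Kato2004.thm12_4 ∧ exists_isNewformOf ∧
      Kato2004.exists_multDivisibilityInputs_nonsplit_contra ∧
      Kato2004.exists_multDivisibilityInputs_split_contra ∧
      Kato2004.exists_multDivisibilityInputs_fine_contra ∧ mazur_not_dvd_maninConstant_of_odd)
    (h2L : kato_charIdeal_dvd_multiplicative_of_surjective ∧ rank_eq_analyticRank_of_analyticRank_le_one)
    (hQ3 : cor514_transfer_of_goodOrdinary_odd ∧ YanZhu2026.thm49_charIdeal_eq_padicLFunction ∧
      thm1_muAlg_transfer_goodOrdinary_of_mult_odd)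
    (hMC3 : ∀ (W : WeierstrassCurve ℚ) [W.IsElliptic] [W.IsGloballyMinimal] (p : ℕ) [Fact p.Prime],
      ClassX11a W p → p = 3 → ¬ X11a.ShaAnUnit W p → ¬ p ∣ padicValInt p W.minimalDiscriminantInt →
      X2.MazurMainConjectureAt W p) :
    Summit.BirchSwinnertonDyer.BirchSwinnertonDyer.Theses.ClassRecordThree.X11aLowerHalfAtThree :=
  lowerAtThree_of_children_r17_three h9 h2L hQ3 hMC3

/-- The `KolyvaginRoadThree` spelling of the turnkey for item 23178 from line r17's `p = 3` children (one statement under two route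
names, `Iff.rfl`).  CONDITIONAL; closes nothing; BSD is not proved. [cite: Miller2011LMS, Def. 1.1 (arXiv:1010.2431 p. 3)]
[cite: MazurTateTeitelbaum1986Invent, §I.14 (shape only)] -/
theorem x11aLowerHalfAtThree_kolyvaginRoadThree_of_children_r17_three
    (h9 : thm61_splitMultiplicative ∧ thm61_nonsplitMultiplicative ∧
      (∀ (W : WeierstrassCurve ℚ) [W.IsElliptic] [W.IsGloballyMinimal] (p : ℕ) [Fact p.Prime],
        p ≠ 2 → greenberg_stevens (W := W) (p := p)) ∧
      Kato2004.thm12_4 ∧ exists_isNewformOf ∧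
      Kato2004.exists_multDivisibilityInputs_nonsplit_contra ∧
      Kato2004.exists_multDivisibilityInputs_split_contra ∧
      Kato2004.exists_multDivisibilityInputs_fine_contra ∧ mazur_not_dvd_maninConstant_of_odd)
    (h2L : kato_charIdeal_dvd_multiplicative_of_surjective ∧ rank_eq_analyticRank_of_analyticRank_le_one)
    (hQ3 : cor514_transfer_of_goodOrdinary_odd ∧ YanZhu2026.thm49_charIdeal_eq_padicLFunction ∧
      thm1_muAlg_transfer_goodOrdinary_of_mult_odd)
    (hMC3 : ∀ (W : WeierstrassCurve ℚ) [W.IsElliptic] [W.IsGloballyMinimal] (p : ℕ) [Fact p.Prime],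
      ClassX11a W p → p = 3 → ¬ X11a.ShaAnUnit W p → ¬ p ∣ padicValInt p W.minimalDiscriminantInt →
      X2.MazurMainConjectureAt W p) :
    Summit.BirchSwinnertonDyer.BirchSwinnertonDyer.Theses.KolyvaginRoadThree.X11aLowerHalfAtThree :=
  lowerAtThree_of_children_r17_three h9 h2L hQ3 hMC3

end Summit.BirchSwinnertonDyer.BirchSwinnertonDyer.Theorems.Birth

end
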